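import Mathlib
import HarnessLib

/-!
# Embedding-dimension bricks (w44b U4): `edim` under `ker ⊆ 𝔪²`, and dimension drop modulo a nonzero prime

Route `ResolutionOfSingularities/HomologicalConductor`, chain W4.4b, rung S-2 `PersistenceSurface`
(stmt-ResolutionOfSingularities-19970); object U4 of res-L1-w44b-plan-1's DE-COLLISION line
(2026-08-27T08:56Z: «the two ingredients … for the edim form o9h of the Sat₄ residual»), taken together
with o9h by res-type-011 (TAKING 09:00Z).  [OURS · folklore commutative algebra; AI-written, weaker than
expert review; no statement of the manuscript under study is used.]

* `ringKrullDim_quotient_add_one_le_of_ne_bot` — (ii) for a noetherian local DOMAIN `R` and a proper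
  ideal `𝔭 ≠ ⊥`: `ringKrullDim (R ⧸ 𝔭) + 1 ≤ ringKrullDim R`;
* `spanFinrank_map_le` — `spanFinrank (I.map π) ≤ spanFinrank I` (`I` finitely generated);
* `spanFinrank_maximalIdeal_eq_of_surjective_of_ker_le_sq` — (i) for a surjection `π : S ↠ T` of local
  rings, `S` noetherian, `ker π ⊆ 𝔪_S²`: `spanFinrank 𝔪_T = spanFinrank 𝔪_S` (Nakayama);
* `exists_ringKrullDim_eq_nat_of_le` — `WithBot ℕ∞` bookkeeping.
Consumer: `Theorems/HomologicalConductorPersistenceSurfaceSaturationEdimPresentation.lean` (o9h).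
-/

noncomputable section

-- single-problem summit: the doubled namespace component `ResolutionOfSingularities` is forced
set_option linter.dupNamespace false

namespace Summit.ResolutionOfSingularities.ResolutionOfSingularities.Theorems.HomologicalConductor.EdimBricks

open IsLocalRing
open scoped nonZeroDivisors

universe u

/-- **Brick (ii): a nonzero prime of a noetherian local domain drops the Krull dimension**:
`dim (R ⧸ 𝔭) + 1 ≤ dim R` for `𝔭 ≠ ⊥` a proper (e.g. prime) ideal of a noetherian local domain `R`
(`𝔭` contains a nonzero `f`, `dim R⧸(f) + 1 = dim R` by Mathlib's
`ringKrullDim_quotient_span_singleton_succ_eq_ringKrullDim_of_mem_nonZeroDivisors`, and `R ⧸ 𝔭` is a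
quotient of `R ⧸ (f)`). [folklore] -/
theorem ringKrullDim_quotient_add_one_le_of_ne_bot {R : Type u} [CommRing R] [IsDomain R]
    [IsNoetherianRing R] [IsLocalRing R] {P : Ideal R} (hP : P ≠ ⊥) (hPtop : P ≠ ⊤) :
    ringKrullDim (R ⧸ P) + 1 ≤ ringKrullDim R := by
  obtain ⟨f, hfP, hf0⟩ := Submodule.exists_mem_ne_zero_of_ne_bot hP
  have hfm : f ∈ maximalIdeal R := le_maximalIdeal hPtop hfP
  have hfreg : f ∈ nonZeroDivisors R := mem_nonZeroDivisors_of_ne_zero hf0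
  rw [← ringKrullDim_quotient_span_singleton_succ_eq_ringKrullDim_of_mem_nonZeroDivisors hfreg hfm]
  have hle : Ideal.span {f} ≤ P := (Ideal.span_singleton_le_iff_mem _).mpr hfP
  have hq : ringKrullDim (R ⧸ P) ≤ ringKrullDim (R ⧸ Ideal.span {f}) :=
    ringKrullDim_le_of_surjective (Ideal.Quotient.factor hle) (Ideal.Quotient.factor_surjective hle)
  exact add_le_add hq le_rfl

/-- Generators map to generators: `spanFinrank (I.map π) ≤ spanFinrank I` for a finitely generated
ideal `I`. [folklore] -/
theorem spanFinrank_map_le {S T : Type u} [CommRing S] [CommRing T] (π : S →+* T) {I : Ideal S}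
    (hI : I.FG) : (I.map π).spanFinrank ≤ I.spanFinrank := by
  classical
  obtain ⟨s, hs, hspan⟩ := Submodule.FG.exists_span_finset_card_eq_spanFinrank hI
  have hspan' : Ideal.span (s : Set S) = I := hspan
  rw [← hspan', Ideal.map_span, hspan', ← hs]
  calc (Ideal.span (π '' (s : Set S))).spanFinrank ≤ (π '' (s : Set S)).ncard :=
        Submodule.spanFinrank_span_le_ncard_of_finite (s.finite_toSet.image π)
    _ ≤ (s : Set S).ncard := Set.ncard_image_le s.finite_toSet
    _ = s.card := Set.ncard_coe_finset s

/-- **Brick (i): the embedding dimension is unchanged by killing an ideal inside `𝔪²`**: for a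
surjection `π : S ↠ T` of local rings (`S` noetherian) with `ker π ⊆ 𝔪_S²`,
`edim T = edim S` (`Submodule.spanFinrank` of the maximal ideals). `≤`: generators map to generators;
`≥`: lift a minimal generating set of `𝔪_T`, then `𝔪_S ⊆ (lifts) + 𝔪_S²` and Nakayama
(`Submodule.le_of_le_smul_of_le_jacobson_bot`). Stated for surjections so that no transport along
`T ≃+* S ⧸ J` is needed downstream. [folklore] -/
theorem spanFinrank_maximalIdeal_eq_of_surjective_of_ker_le_sq {S T : Type u} [CommRing S]
    [CommRing T] [IsLocalRing S] [IsNoetherianRing S] [IsLocalRing T] (π : S →+* T)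
    (hπ : Function.Surjective π) (hker : RingHom.ker π ≤ (maximalIdeal S) ^ 2) :
    (maximalIdeal T).spanFinrank = (maximalIdeal S).spanFinrank := by
  classical
  have hmap : (maximalIdeal S).map π = maximalIdeal T := map_maximalIdeal_of_surjective π hπ
  have hfgS : (maximalIdeal S).FG := IsNoetherian.noetherian _
  apply le_antisymm
  · rw [← hmap]
    exact spanFinrank_map_le π hfgS
  · -- Nakayama
    haveI : IsNoetherianRing T := isNoetherianRing_of_surjective S T π hπ
    have hfgT : (maximalIdeal T).FG := IsNoetherian.noetherian _
    obtain ⟨t, ht, hspan0⟩ := Submodule.FG.exists_span_finset_card_eq_spanFinrank hfgT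
    have hspan : Ideal.span (t : Set T) = maximalIdeal T := hspan0
    choose g hg using fun y : T => hπ y
    let s : Finset S := t.image g
    have hst : s.card ≤ t.card := Finset.card_image_le
    have hπs : π '' (s : Set S) = (t : Set T) := by
      ext y
      simp only [s, Finset.coe_image, Set.image_image, hg, Set.image_id']
    -- `span s ≤ 𝔪_S`
    have hsm : Ideal.span (s : Set S) ≤ maximalIdeal S := by
      rw [Ideal.span_le]
      intro x hx
      obtain ⟨y, hy, rfl⟩ := Finset.mem_image.mp (Finset.mem_coe.mp hx)
      have hyT : y ∈ maximalIdeal T := by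
        rw [← hspan]; exact Submodule.subset_span (Finset.mem_coe.mpr hy)
      -- `g y` is a nonunit since `π (g y) = y` is
      intro hunit
      exact hyT (by rw [← hg y]; exact hunit.map π)
    -- `𝔪_S ≤ span s ⊔ 𝔪_S • 𝔪_S`
    have key : (maximalIdeal S : Submodule S S) ≤
        Ideal.span (s : Set S) ⊔ (maximalIdeal S) • (maximalIdeal S : Submodule S S) := by
      intro y hy
      have hyT : π y ∈ (Ideal.span (s : Set S)).map π := by
        rw [Ideal.map_span, hπs, hspan, ← hmap]
        exact Ideal.mem_map_of_mem π hy
      obtain ⟨z, hz, hzy⟩ := (Ideal.mem_map_iff_of_surjective π hπ).mp hyT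
      have hyz : y - z ∈ RingHom.ker π := by
        rw [RingHom.mem_ker, map_sub, hzy, sub_self]
      have hyz' : y - z ∈ (maximalIdeal S) • (maximalIdeal S : Submodule S S) := by
        rw [Ideal.smul_eq_mul, ← pow_two]
        exact hker hyz
      have : y = z + (y - z) := by ring
      rw [this]
      exact Submodule.add_mem_sup hz hyz'
    have hN : (maximalIdeal S : Submodule S S) ≤ Ideal.span (s : Set S) :=
      Submodule.le_of_le_smul_of_le_jacobson_bot hfgS (maximalIdeal_le_jacobson ⊥) key
    have heq : maximalIdeal S = Ideal.span (s : Set S) := le_antisymm hN hsm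
    calc (maximalIdeal S).spanFinrank = (Ideal.span (s : Set S)).spanFinrank := by rw [heq]
      _ ≤ (s : Set S).ncard := Submodule.spanFinrank_span_le_ncard_of_finite s.finite_toSet
      _ = s.card := Set.ncard_coe_finset s
      _ ≤ t.card := hst
      _ = _ := ht

/-- A nontrivial ring of Krull dimension `≤ d` has Krull dimension some natural number `≤ d`
(`ringKrullDim` lives in `WithBot ℕ∞`). [folklore] -/
theorem exists_ringKrullDim_eq_nat_of_le {T : Type u} [CommRing T] [Nontrivial T] {d : ℕ}
    (h : ringKrullDim T ≤ d) : ∃ d' : ℕ, ringKrullDim T = d' ∧ d' ≤ d := by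
  have h0 : (0 : WithBot ℕ∞) ≤ ringKrullDim T := ringKrullDim_nonneg_of_nontrivial
  generalize hq : ringKrullDim T = q at h0 h
  induction q using WithBot.recBotCoe with
  | bot => exact absurd h0 (by simp)
  | coe q =>
    induction q using ENat.recTopCoe with
    | top =>
      exfalso
      have h' : (⊤ : ℕ∞) ≤ (d : ℕ∞) := WithBot.coe_le_coe.mp h
      exact absurd (top_le_iff.mp h') (ENat.coe_ne_top d)
    | coe d' =>
      refine ⟨d', rfl, ?_⟩
      have h' : (d' : ℕ∞) ≤ (d : ℕ∞) := WithBot.coe_le_coe.mp h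
      exact_mod_cast h'


end Summit.ResolutionOfSingularities.ResolutionOfSingularities.Theorems.HomologicalConductor.EdimBricks

end
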